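/-
Copyright: statement-level skeleton of a published paper (lit-balaban cell, Phase-2 proof seat p18, gen 7). No claims beyond
what the kernel checks below.
-/
import Mathlib
import Literature.MathematicalPhysics.QuantumFieldTheory.Balaban1983to89.B3FreeLineDegrees

/-!
# B3 — T. Bałaban, *(Higgs)₂,₃ quantum fields in a finite volume. III. Renormalization*, CMP **88** (1983) 411–445
[Balaban1983Higgs3] — Proposition 2.2 p. 428: the localized lattice graph amplitudes over the generalized graphs with free
line exponents — (2.6)/(2.7) (total amplitude, relabeling along an ordering) and the IBP-ready class for the (2.4) exception

statement-level skeleton of published theorems with citation tags; proofs where landed; nothing here is a claim about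
the Yang–Mills mass gap

PDF held: `paper:balaban1983-higgs-2-3-quantum-fields-finite-volume` (journal page = PDF page + 410).

Part of the Phase-2 work on SKELETON row **B3.Prop2.2** (unit `lit-balaban-p18` gen 7, HOME `run/shared/lean/pub/lit-balaban/`;
the fold owner's closing item «free line exponent κ_l»): files `B3FreeLineDegrees` → `B3FreeLineAmplitude` (this file) →
`B3FreeLineIBP` → `B3Prop22FreeLines`; built on seat p19's chain without editing it.

WHAT IS REPRODUCED.  p. 428 [PDF 18]: *"The only thing which matters is that propagators have representations corresponding
to (2.6) with the estimates corresponding to (2.10)–(2.12), so that we have the inequality (2.13) with the proper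
generalization of (2.14)."*  p19's class `B3Ineq213.Amp M` of LOCALIZED LATTICE GRAPH AMPLITUDES is already stated over an
arbitrary generalized graph `M : B3Ineq215.Model` (line dimensions `M.a`), and its (2.13) `Amp.abs_E_le` is proved at that
generality; but the bookkeeping of (2.6)/(2.7) (`Amp.pref`, `Amp.Etot`, `Amp.relabel`) and the IBP-ready class `IBPAmp` of
the (2.4) exception were written over `Counts.toModel` only.  KERNEL-CHECKED HERE, for the generalized graphs `Counts.toModelK
G κ` of `B3FreeLineDegrees` (line `l` of dimension `lineDim l + κ_l`): the prefactor `e^{d_v}λ^{d_s}exp[−δ₀d({□(v)})]ΠN^ΦΠN^A`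
and the total amplitude `E(G′, {□(v)}, Φ′, A)` of (2.6) in Model-generic form (`Amp.prefM`, `Amp.EtotM`, agreeing with p19's
by `rfl` on `Counts.toModel`: `prefM_eq_pref`, `EtotM_eq_Etot`) with **(2.6)** `EtotM_eq_sum_E` (*"We can write E(G′) as a sum
Σ_j E(G′(j))"*, p. 424) and (2.13) in that currency (`abs_E_le_prefM`); **(2.7)**, the relabeling of a generalized amplitude
along an ordering l̃ = σ (`Amp.relabelK`: the extra exponents travel with the lines, `E_relabelK`, `prod_C_relabelK`,
`relabelK_prefM`); and the **IBP-ready class `IBPAmpK G κ`** (p19's `IBPAmp` verbatim over `toModelK`: bond directions,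
undifferentiated kernels `K♭_l` with `K_l = ∂⁺K♭_l` and (2.10) at dimension `a_l + 1`, face-vanishing localization with the
differentiated vertex bound, the derivative budget (2.10) of every kernel — *"for each differentiation, there is an additional
factor (L^jη)^{−1}"*, p. 426) with its budget lemma and its relabeling along an ordering.  HONEST SCOPE: as in p19's files the
analytic inputs (2.5)/(2.10)–(2.12) and the IBP-readiness are hypotheses (fields) of the class, not derived from Propositions
I.2.1/I.2.3 (rows B3.Eq2.5, B3.Eq2.10–2.12).
-/

open Finset

namespace Literature.MathematicalPhysics.QuantumFieldTheory.Balaban1983to89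

namespace B3Ineq213

open B3Ineq215 B3FreeLine

variable {V : Type} [Fintype V] [DecidableEq V] {m : ℕ}

/-! ## (2.6) and the prefactor of (1.33), over an arbitrary generalized graph -/

namespace Amp

section Generic

variable {M : Model V m} (A : Amp M)

/-- The coupling/decay/norm factor of (1.33)/(2.13) over an arbitrary generalized graph: `e^{d_v(G)} λ^{d_s(G)}
exp[−δ₀ d({□(v)})] (Π_v N^Φ_v)(Π_v N^A_v)` (cf. p19's `Amp.pref` over `Counts.toModel`). [cite: Balaban1983Higgs3, (1.33) p.420] -/
noncomputable def prefM : ℝ :=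
  A.eRun ^ (∑ v, A.dv v) * A.lamRun ^ (∑ v, A.ds v) * Real.exp (-(M.δ₀ * boxTreeLen M.L A.k A.box))
    * (∏ v, A.NPhi v) * ∏ v, A.NA v

/-- `prefM ≥ 0`. [cite: Balaban1983Higgs3, (1.33) p.420] -/
theorem prefM_nonneg : 0 ≤ A.prefM := by
  unfold prefM
  have := A.eRun_nonneg
  have := A.lamRun_nonneg
  have h1 : 0 ≤ ∏ v, A.NPhi v := prod_nonneg fun v _ => A.NPhi_nonneg v
  have h2 : 0 ≤ ∏ v, A.NA v := prod_nonneg fun v _ => A.NA_nonneg v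
  positivity

/-- **The total localized amplitude `E(G′, {□(v)}, Φ′_ext, A_ext)`** over an arbitrary generalized graph: every line carries
its full propagator `Σ_{t<k} K_l(t; ·, ·)` ((2.6); cf. p19's `Amp.Etot` over `Counts.toModel`). [cite: Balaban1983Higgs3, (2.6) p.424] -/
noncomputable def EtotM : ℝ :=
  ∑ x ∈ boxPositions M.L A.k A.box,
    (∏ v, A.η ^ M.d * A.u v (x v)) * ∏ l, ∑ t : Fin A.k, A.K l (t : ℕ) (x (M.src l)) (x (M.tgt l))

/-- **(2.6)** p. 424 [PDF 14]: *"We can write E(G′) as a sum Σ_j E(G′(j))"* — multilinearity in the line kernels, over an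
arbitrary generalized graph. [cite: Balaban1983Higgs3, (2.6) p.424] -/
theorem EtotM_eq_sum_E : A.EtotM = ∑ j : Fin m → Fin A.k, A.E (fun l => (j l : ℕ)) := by
  unfold EtotM E
  have h : ∀ x : V → Fin M.d → ℕ,
      (∏ l, ∑ t : Fin A.k, A.K l (t : ℕ) (x (M.src l)) (x (M.tgt l)))
        = ∑ j : Fin m → Fin A.k, ∏ l, A.K l ((j l : Fin A.k) : ℕ) (x (M.src l)) (x (M.tgt l)) := by
    intro x
    rw [Finset.prod_univ_sum (fun _ : Fin m => (Finset.univ : Finset (Fin A.k)))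
      (fun l t => A.K l (t : ℕ) (x (M.src l)) (x (M.tgt l))), Fintype.piFinset_univ]
  simp_rw [h, Finset.mul_sum]
  exact Finset.sum_comm

/-- (2.13) in this currency: `|E(G(j), …)| ≤ (Π_l C_l) · prefM · Σ_{{Δ(v)}} Ẽ(G(j), {Δ(v)})` (p19's `Amp.abs_E_le`).
[cite: Balaban1983Higgs3, (2.13) p.426] -/
theorem abs_E_le_prefM {j : Fin m → ℕ} (hj : j ∈ Model.Mon m A.k) :
    |A.E j| ≤ (∏ l, A.C l) * A.prefM * M.W 0 A.k j A.box :=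
  A.abs_E_le hj

end Generic

section Compat

variable {G : Counts V m} (A : Amp G.toModel)

/-- On `Counts.toModel` the generic prefactor IS p19's `Amp.pref`. [cite: Balaban1983Higgs3, (1.33) p.420] -/
theorem prefM_eq_pref : A.prefM = A.pref := rfl

/-- On `Counts.toModel` the generic total amplitude IS p19's `Amp.Etot`. [cite: Balaban1983Higgs3, (2.6) p.424] -/
theorem EtotM_eq_Etot : A.EtotM = A.Etot := rfl

end Compat

/-! ## (2.7): relabeling a generalized amplitude along an ordering -/

section FreeLine

variable {G : Counts V m} {κ : Fin m → ℚ} (A : Amp (G.toModelK κ))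

/-- The amplitude over the generalized graph with its lines renumbered along the ordering l̃ = σ: kernels, constants AND
the extra exponents carried along (the new line `i` is the old line `σ i`, of dimension `lineDim (σ i) + κ (σ i)`).
[cite: Balaban1983Higgs3, (2.7) p.425] -/
noncomputable def relabelK (σ : Equiv.Perm (Fin m)) : Amp ((relabelCounts G σ).toModelK (κ ∘ σ)) where
  k := A.k
  box := A.box
  u := A.u
  K := fun i => A.K (σ i)
  C := fun i => A.C (σ i)
  eRun := A.eRun
  lamRun := A.lamRun
  dv := A.dv
  ds := A.ds
  NPhi := A.NPhi
  NA := A.NA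
  C_nonneg := fun i => A.C_nonneg (σ i)
  eRun_nonneg := A.eRun_nonneg
  lamRun_nonneg := A.lamRun_nonneg
  NPhi_nonneg := A.NPhi_nonneg
  NA_nonneg := A.NA_nonneg
  e_nonneg := A.e_nonneg
  conn := by
    intro u w
    refine Relation.EqvGen.mono ?_ u w (A.conn u w)
    rintro a b ⟨l, ha, hb⟩
    refine ⟨σ.symm l, ?_, ?_⟩
    · show G.src (σ (σ.symm l)) = a
      rw [Equiv.apply_symm_apply]
      exact ha
    · show G.tgt (σ (σ.symm l)) = b
      rw [Equiv.apply_symm_apply]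
      exact hb
  u_le := A.u_le
  K_le := fun i t ht x x' => A.K_le (σ i) t ht x x'

/-- The product of the kernel constants is unchanged by relabeling. [cite: Balaban1983Higgs3, (2.7) p.425] -/
theorem prod_C_relabelK (σ : Equiv.Perm (Fin m)) : ∏ i, (A.relabelK σ).C i = ∏ l, A.C l := by
  show ∏ i, A.C (σ i) = ∏ l, A.C l
  exact Equiv.prod_comp σ A.C

/-- **(2.7), the relabeling step** for the generalized amplitudes: the amplitude at `j` equals the relabeled amplitude at
`j ∘ σ`. [cite: Balaban1983Higgs3, (2.7) p.425] -/
theorem E_relabelK (σ : Equiv.Perm (Fin m)) (j : Fin m → ℕ) : (A.relabelK σ).E (j ∘ σ) = A.E j := by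
  unfold E
  refine sum_congr rfl fun x _ => ?_
  congr 1
  show ∏ i, A.K (σ i) (j (σ i)) (x (G.src (σ i))) (x (G.tgt (σ i))) = ∏ l, A.K l (j l) (x (G.src l)) (x (G.tgt l))
  exact Equiv.prod_comp σ (fun l => A.K l (j l) (x (G.src l)) (x (G.tgt l)))

/-- Relabeling does not change the prefactor. [cite: Balaban1983Higgs3, (2.7) p.425] -/
theorem relabelK_prefM (σ : Equiv.Perm (Fin m)) : (A.relabelK σ).prefM = A.prefM := rfl

end FreeLine

end Amp

/-! ## The IBP-ready amplitudes over the generalized graphs -/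

section Ready

/-- **An IBP-READY localized lattice graph amplitude over the generalized graph `Counts.toModelK G κ`** (p19's `IBPAmp`
verbatim, with the line dimensions `lineDim l + κ_l`): an amplitude of the class `Amp` with a bond direction per vertex; for
every differentiated line `l` with two endpoints the undifferentiated kernel `K♭_l`, `K_l = ∂⁺_{dir s(l)} K♭_l` in the first
variable, obeying (2.10) with the dimension `a_l + 1`; the vertex function at `s(l)` vanishing on the `dir s(l)`-faces of
`□(s(l))` with `|∂⁻ u_{s(l)}| ≤ cD ×` the vertex bound; and the derivative budget (2.10) of every kernel (*"for each
differentiation, there is an additional factor (L^jη)^{−1}"*). [cite: Balaban1983Higgs3, (2.8) p.425] -/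
structure IBPAmpK (G : Counts V m) (κ : Fin m → ℚ) extends Amp (G.toModelK κ) where
  /-- the bond direction of the derivative leg at each vertex -/
  dir : V → Fin (G.toModelK κ).d
  /-- the undifferentiated kernels `K♭_l` -/
  Kb : Fin m → Ker (G.toModelK κ).d
  /-- the constant of the differentiated vertex bound -/
  cD : ℝ
  one_le_cD : 1 ≤ cD
  /-- `K_l = ∂⁺_{dir s(l)} K♭_l` in the first variable, on every differentiated line with two endpoints -/
  K_eq : ∀ l, G.src l ≠ G.tgt l → 1 ≤ G.diffOn (G.src l) l → ∀ t x y,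
    K l t x y = fdiffQ (((G.toModelK κ).L : ℝ) ^ k) (dir (G.src l)) (fun x' => Kb l t x' y) x
  /-- (2.10) for `K♭_l` with the dimension `a_l + 1` -/
  Kb_le : ∀ l, G.src l ≠ G.tgt l → 1 ≤ G.diffOn (G.src l) l →
    KBd (G.toModelK κ) k (C l) ((G.toModelK κ).a l + 1) (Kb l)
  /-- the vertex function at `s(l)` vanishes on the two `dir s(l)`-faces of its cube -/
  u_face : ∀ l, G.src l ≠ G.tgt l → 1 ≤ G.diffOn (G.src l) l →
    FaceVanishing (G.toModelK κ).L (⟨k, box (G.src l)⟩ : Cube (G.toModelK κ).d) (dir (G.src l)) (u (G.src l))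
  /-- the differentiated vertex bound -/
  du_le : ∀ l, G.src l ≠ G.tgt l → 1 ≤ G.diffOn (G.src l) l → ∀ x,
    |bdiffQ (((G.toModelK κ).L : ℝ) ^ k) (dir (G.src l)) (u (G.src l)) x|
      ≤ cD * (eRun ^ dv (G.src l) * lamRun ^ ds (G.src l) * NPhi (G.src l) * NA (G.src l)
        * ((((G.toModelK κ).L : ℝ) ^ k)⁻¹) ^ (G.toModelK κ).e (G.src l))
  /-- (2.10) with one more difference quotient in the first variable -/
  KdX_le : ∀ l μ, KBd (G.toModelK κ) k (C l) ((G.toModelK κ).a l - 1)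
    (dK (((G.toModelK κ).L : ℝ) ^ k) μ true false (K l))
  /-- (2.10) with one more difference quotient in the second variable -/
  KdY_le : ∀ l ν, KBd (G.toModelK κ) k (C l) ((G.toModelK κ).a l - 1)
    (dK (((G.toModelK κ).L : ℝ) ^ k) ν false true (K l))
  /-- (2.10) with one more difference quotient in each variable -/
  KdXY_le : ∀ l μ ν, KBd (G.toModelK κ) k (C l) ((G.toModelK κ).a l - 2)
    (dK (((G.toModelK κ).L : ℝ) ^ k) μ true false (dK (((G.toModelK κ).L : ℝ) ^ k) ν false true (K l)))

namespace IBPAmpK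

variable {G : Counts V m} {κ : Fin m → ℚ} (A : IBPAmpK G κ)

/-- The derivative budget of each kernel. [cite: Balaban1983Higgs3, (2.10) p.426] -/
theorem budget (l : Fin m) : KBudget (G.toModelK κ) A.k (A.C l) ((G.toModelK κ).a l) (A.K l) :=
  ⟨A.K_le l, A.KdX_le l, A.KdY_le l, A.KdXY_le l⟩

/-- The IBP-ready generalized amplitude with its lines renumbered along the ordering l̃ = σ (`Amp.relabelK` plus the
readiness data carried along). [cite: Balaban1983Higgs3, (2.7) p.425] -/
noncomputable def relabel (σ : Equiv.Perm (Fin m)) : IBPAmpK (relabelCounts G σ) (κ ∘ σ) where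
  toAmp := A.toAmp.relabelK σ
  dir := A.dir
  Kb := fun i => A.Kb (σ i)
  cD := A.cD
  one_le_cD := A.one_le_cD
  K_eq := fun i hne hd t x y => A.K_eq (σ i) hne hd t x y
  Kb_le := fun i hne hd => A.Kb_le (σ i) hne hd
  u_face := fun i hne hd => A.u_face (σ i) hne hd
  du_le := fun i hne hd x => A.du_le (σ i) hne hd x
  KdX_le := fun i μ => A.KdX_le (σ i) μ
  KdY_le := fun i ν => A.KdY_le (σ i) ν
  KdXY_le := fun i μ ν => A.KdXY_le (σ i) μ ν

/-- Relabeling does not change the prefactor. [cite: Balaban1983Higgs3, (2.7) p.425] -/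
theorem relabel_prefM (σ : Equiv.Perm (Fin m)) : (A.relabel σ).toAmp.prefM = A.toAmp.prefM := rfl

/-- Relabeling keeps the differentiated-vertex constant. [cite: Balaban1983Higgs3, (2.7) p.425] -/
theorem relabel_cD (σ : Equiv.Perm (Fin m)) : (A.relabel σ).cD = A.cD := rfl

/-! ### Non-vacuity of the class -/

/-- The zero amplitude over a connected count datum with any extra exponents is IBP-ready (all vertex functions and
kernels `0`, constants `0`, `cD = 1`). [cite: Balaban1983Higgs3, Prop. 2.2 p.428] -/
noncomputable def zero (G : Counts V m) (κ : Fin m → ℚ) (hG : LinesConnect G.src G.tgt) (k : ℕ)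
    (box : V → Fin (G.toModelK κ).d → ℕ) : IBPAmpK G κ where
  k := k
  box := box
  u := fun _ _ => 0
  K := fun _ _ _ _ => 0
  C := fun _ => 0
  eRun := 1
  lamRun := 1
  dv := fun _ => 0
  ds := fun _ => 0
  NPhi := fun _ => 0
  NA := fun _ => 0
  C_nonneg := fun _ => le_rfl
  eRun_nonneg := zero_le_one
  lamRun_nonneg := zero_le_one
  NPhi_nonneg := fun _ => le_rfl
  NA_nonneg := fun _ => le_rfl
  e_nonneg := fun v => Nat.cast_nonneg _
  conn := hG
  u_le := fun v x => by simp
  K_le := fun l t _ x y => by simp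
  dir := fun _ => ⟨0, G.d_pos⟩
  Kb := fun _ _ _ _ => 0
  cD := 1
  one_le_cD := le_rfl
  K_eq := fun l _ _ t x y => by simp [fdiffQ]
  Kb_le := fun l _ _ t _ x y => by simp
  u_face := fun l _ _ x _ => rfl
  du_le := fun l _ _ x => by simp [bdiffQ]
  KdX_le := fun l μ t _ x y => by simp [dK, shK]
  KdY_le := fun l ν t _ x y => by simp [dK, shK]
  KdXY_le := fun l μ ν t _ x y => by simp [dK, shK]

end IBPAmpK

end Ready

end B3Ineq213

end Literature.MathematicalPhysics.QuantumFieldTheory.Balaban1983to89
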